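import Summits.NavierStokesRegularity.NavierStokesRegularity.Theorems.StrainDoorsDefs
import HarnessLib

/-!
# StrainDoorsCompositions — door family S37 «StrainDoors»: door Λ «SubcriticalStrainDoor» CLOSED from S35-B, and
# door H «StrainFeedingDoor» from the plates (two-slab barrier)

P0-37 part 2 of 3: §5–§6 (`subcriticalStrainDoor_of`, `subcriticalStrainDoor_holds`, `strainFeedingDoor_of`) of nsreg-p1 g31's `r35/Sketch37.lean` sha16 265cb074f1d98fd0 (ROUND-35
c653b89364d543f7; PLATE-AID-37 a5968f2ee6b16dfe cut), every declaration byte-identical, order preserved; landed by ns-s29-p2 g4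
on LEAD ns-s30-p1 g3's key 2026-08-28T18:39:13Z (a), `--supports stmt-NavierStokesRegularity-0056 --as helper`.  Texts in
`Theorems/StrainDoorsDefs.lean`.

HONEST FRAME: regularity CRITERIA read at ONE POINT PER TIME (the argmax of the strain quotient `⟪∇u e, e⟫`); UNCONDITIONAL
where closed (no named-fact hypothesis); item 0056 `NoTypeII` and NS regularity are NOT proved; nothing here is a route or a
summit statement.
-/

noncomputable section

open MeasureTheory Set Function Filter Metric Real InnerProductSpace
open _root_.Topology
open scoped ENNReal NNReal RealInnerProductSpace ContDiff Laplacian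
open Literature.Analysis Literature.Analysis.FluidPDE
open Literature.Analysis.FluidPDE.VorticityDirectionDynamics

set_option linter.dupNamespace false

namespace Summit.NavierStokesRegularity.NavierStokesRegularity.Theorems.StrainDoors

open Summit.NavierStokesRegularity.NavierStokesRegularity.Theorems.ArgmaxDoors

-- nested operator types (second derivatives)
set_option maxSynthPendingDepth 3
/-! ## §5 Door S37-Λ closed from door S35-B -/

/-- **Door S37-Λ from door S35-B**: `ArgmaxSubcriticalDoor → SubcriticalStrainDoor`. At a vorticity argmax with
`ω ≠ 0`, `netStretch = |ω|²(⟪ξ,∇u ξ⟫ − ν|∇ξ|²_F) ≤ |ω|²·⟪∇u ξ, ξ⟫` (`|ξ| = 1`), so `(T−t)⟪∇u e,e⟫ ≤ y₀` for all unit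
`e` gives S35-B's hypothesis with `a = y₀` (any `ε`, here `√3/8`). [folklore] -/
theorem subcriticalStrainDoor_of (hB : ArgmaxSubcriticalDoor) : SubcriticalStrainDoor := by
  intro ν T t₀ y₀ hν ht₀ ht₀T hy₀ u p hsol hreg hq
  have h3 : 0 < Real.sqrt 3 := Real.sqrt_pos.2 (by norm_num)
  have hε : (0 : ℝ) < Real.sqrt 3 / 8 := by positivity
  have hε' : Real.sqrt 3 / 8 < Real.sqrt 3 / 4 := by linarith
  refine hB ν T t₀ y₀ (Real.sqrt 3 / 8) hν ht₀ ht₀T hy₀ hε hε' u p hsol hreg ?_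
  intro t ht x hx hbig
  have hTt : 0 < T - t := sub_pos.2 ht.2
  have hne : curl (u t) x ≠ 0 := by
    intro h0
    rw [h0, norm_zero, mul_zero] at hbig
    linarith
  have hξ : ‖vorticityDirection (curl (u t)) x‖ = 1 := norm_vorticityDirection _ hne
  have hqξ := hq t ht x (vorticityDirection (curl (u t)) x) hξ
  rw [netStretch_eq]
  have hfrob : 0 ≤ ν * frobeniusNormSq (fderiv ℝ (vorticityDirection (curl (u t))) x) :=
    mul_nonneg hν.le (frobeniusNormSq_nonneg _)
  have hcomm : ⟪vorticityDirection (curl (u t)) x,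
      fderiv ℝ (u t) x (vorticityDirection (curl (u t)) x)⟫ =
        strainQuad u t x (vorticityDirection (curl (u t)) x) := by
    unfold strainQuad
    exact real_inner_comm _ _
  rw [hcomm]
  have hω2 : 0 ≤ ‖curl (u t) x‖ ^ 2 := sq_nonneg _
  calc (T - t) * (‖curl (u t) x‖ ^ 2 *
        (strainQuad u t x (vorticityDirection (curl (u t)) x) -
          ν * frobeniusNormSq (fderiv ℝ (vorticityDirection (curl (u t))) x)))
      ≤ (T - t) * (‖curl (u t) x‖ ^ 2 * strainQuad u t x (vorticityDirection (curl (u t)) x)) := by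
        apply mul_le_mul_of_nonneg_left _ hTt.le
        apply mul_le_mul_of_nonneg_left _ hω2
        linarith
    _ = ((T - t) * strainQuad u t x (vorticityDirection (curl (u t)) x)) * ‖curl (u t) x‖ ^ 2 := by ring
    _ ≤ y₀ * ‖curl (u t) x‖ ^ 2 := mul_le_mul_of_nonneg_right hqξ hω2

/-- **Door S37-Λ «SubcriticalStrainDoor» CLOSED** (S35-B is closed in the tree:
`argmaxSubcriticalDoor_holds_of_threshold`, p646275). [folklore] -/
theorem subcriticalStrainDoor_holds : SubcriticalStrainDoor :=
  subcriticalStrainDoor_of argmaxSubcriticalDoor_holds_of_threshold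

/-! ## §6 Door S37-H from the plates (two-slab barrier) -/

/-- **Door S37-H from the plates**: `StrainGrowth → StrainFrame → StrainThreshold → SubcriticalStrainDoor →
StrainFeedingDoor`. With `κ = ½(y₀² + y₀ − c) > 0`, `Y = y₀ + (T−t₀)M + 1` (`M` a bound of `|∇u(t₀)|`), slab 1
`[t₀,τ]` carries the barrier `B₁ = y(t)/(T−t)`, `y(t) = Y − κ log((T−t₀)/(T−t))` (`(T−t)y' = −κ ≥ c − y − y²` while
`y ≥ y₀`), down to `y(τ) = y₀` at `T − τ = (T−t₀)e^{−(Y−y₀)/κ}`; slab 2 `[τ,t₂]` (every `t₂ < T`) carries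
`B₂ = y₀/(T−t)` (`c ≤ y₀ + y₀²`). Above either barrier `(T−t)⟪∇u ē,ē⟫ > y₀`, where E1_S + F_S + the door hypothesis
give `∂ₜ⟪∇u ē,ē⟫ ≤ −⟪∇u ē,ē⟫² + c/(T−t)²`; E2_S propagates; `(T−t)Λ ≤ y₀` on `[τ,T)` is door Λ's hypothesis.
[folklore] -/
theorem strainFeedingDoor_of (hG : StrainGrowth) (hFr : StrainFrame) (hTh : StrainThreshold)
    (hΛ : SubcriticalStrainDoor) : StrainFeedingDoor := by
  intro ν T t₀ y₀ c hν ht₀ ht₀T hy₀ hy₀1 hc u p hsol hreg hhyp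
  -- WLOG `0 ≤ c` (replace `c` by `max c 0 < y₀(1+y₀)`)
  wlog hc0 : 0 ≤ c generalizing c with Hwlog
  · exact Hwlog (max c 0) (max_lt hc (by positivity))
      (fun t ht x e hax hbig => (hhyp t ht x e hax hbig).trans (le_max_left _ _)) (le_max_right _ _)
  have hT : 0 < T := lt_of_le_of_lt ht₀ ht₀T
  have hTt₀ : 0 < T - t₀ := sub_pos.2 ht₀T
  -- ### Step 0: the Riccati inequality at the charged strain argmaxes
  have hgrowth : ∀ t ∈ Ico t₀ T, ∀ (x e : EuclideanSpace ℝ (Fin 3)), IsStrainArgmax u t x e →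
      y₀ < (T - t) * strainQuad u t x e →
      strainRate T u t x e ≤ -(strainQuad u t x e) ^ 2 + c / (T - t) ^ 2 := by
    intro t ht x e hax hbig
    have ht' : t ∈ Ico 0 T := ⟨ht₀.trans ht.1, ht.2⟩
    have hTt : 0 < T - t := sub_pos.2 ht.2
    have hsm : ContDiff ℝ ∞ (u t) := hsol.smooth_velocity.contDiff_slice ht'
    have heq := hFr ν T hν hT u p hsol t ht' x e
    have hE := hG ν hν.le (u t) (p t) hsm x e hax.1 (fun y => hax.2 y e hax.1) _ heq
    have hfeed := hhyp t ht x e hax hbig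
    have hfeed' : strainFeed u p t x e ≤ c / (T - t) ^ 2 := by
      rw [le_div_iff₀ (by positivity)]
      linarith [hfeed]
    have h1 : strainRate T u t x e ≤ -(strainQuad u t x e) ^ 2 + strainFeed u p t x e := by
      unfold strainRate strainQuad strainFeed pressureHess
      linarith [hE]
    linarith
  -- ### Step 1: a bound for the strain form at time `t₀`
  obtain ⟨M, hM0, hM⟩ : ∃ M : ℝ, 0 ≤ M ∧
      ∀ (x e : EuclideanSpace ℝ (Fin 3)), ‖e‖ = 1 → strainQuad u t₀ x e ≤ M := by
    set T'' : ℝ := (t₀ + T) / 2 with hT''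
    have hT''T : T'' < T := by rw [hT'']; linarith
    have ht₀T'' : t₀ ≤ T'' := by rw [hT'']; linarith
    have hT''0 : 0 < T'' := by rw [hT'']; linarith
    have hS : IsClassicalNSSolutionOn (Icc 0 T'') ν 0 u p :=
      hsol.mono (Icc_subset_Ico_right hT''T) (uniqueDiffOn_Icc hT''0)
    have hBn : HasBoundedSobolevNormsOn (Icc 0 T'') u := hreg T'' hT''T
    obtain ⟨B₁, B₂, hB₁, -, hpk⟩ := IntenseSetDoors.slice_package hS hBn
    refine ⟨B₁, hB₁, fun x e he => ?_⟩
    obtain ⟨-, -, -, -, -, hgrad, -⟩ := hpk t₀ ⟨ht₀, ht₀T''⟩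
    calc strainQuad u t₀ x e ≤ ‖fderiv ℝ (u t₀) x e‖ * ‖e‖ := real_inner_le_norm _ _
      _ ≤ ‖fderiv ℝ (u t₀) x‖ * ‖e‖ * ‖e‖ := by
          gcongr
          exact ContinuousLinearMap.le_opNorm _ _
      _ ≤ B₁ := by rw [he, mul_one, mul_one]; exact hgrad x
  -- ### Step 2: constants of the two-slab barrier
  have hgap : 0 < y₀ ^ 2 + y₀ - c := by nlinarith [hc]
  set κ : ℝ := (y₀ ^ 2 + y₀ - c) / 2 with hκ
  have hκ0 : 0 < κ := by rw [hκ]; linarith [hgap]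
  set Y : ℝ := y₀ + (T - t₀) * M + 1 with hY
  have hYy₀ : y₀ < Y := by have := mul_nonneg hTt₀.le hM0; rw [hY]; linarith
  have hY0 : 0 < Y := hy₀.trans hYy₀
  -- the Riccati margin: `c + κ ≤ y + y²` for `y ≥ y₀`
  have hquad : ∀ y : ℝ, y₀ ≤ y → c + κ ≤ y + y ^ 2 := by
    intro y hy
    have h1 : c + κ ≤ y₀ + y₀ ^ 2 := by rw [hκ]; nlinarith [hc]
    have h2 : 0 ≤ (y - y₀) * (y + y₀ + 1) := mul_nonneg (sub_nonneg.2 hy) (by linarith)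
    nlinarith
  -- `ρ = e^{−(Y − y₀)/κ} ∈ (0,1)`, `τ = T − (T − t₀)ρ`
  set ρ : ℝ := Real.exp (-((Y - y₀) / κ)) with hρ
  have hρ0 : 0 < ρ := Real.exp_pos _
  have hρ1 : ρ < 1 := by
    have h : Real.exp (-((Y - y₀) / κ)) < Real.exp 0 :=
      Real.exp_lt_exp.2 (by have := div_pos (sub_pos.2 hYy₀) hκ0; linarith)
    rwa [Real.exp_zero] at h
  have hlogρ : Real.log ρ = -((Y - y₀) / κ) := by rw [hρ, Real.log_exp]
  set τ : ℝ := T - (T - t₀) * ρ with hτ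
  have hTτ : T - τ = (T - t₀) * ρ := by rw [hτ]; ring
  have hTτ0 : 0 < T - τ := by rw [hTτ]; exact mul_pos hTt₀ hρ0
  have ht₀τ : t₀ < τ := by
    have : (T - t₀) * ρ < (T - t₀) * 1 := mul_lt_mul_of_pos_left hρ1 hTt₀
    rw [hτ]; linarith
  have hτT : τ < T := by linarith
  have hτ0 : 0 ≤ τ := ht₀.trans ht₀τ.le
  -- ### Step 3: slab 1, `[t₀, τ]`, barrier `B₁ = (C₀ + κ log (T − t)) / (T − t)`
  set C₀ : ℝ := Y - κ * Real.log (T - t₀) with hC₀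
  set Bf : ℝ → ℝ := fun t => (C₀ + κ * Real.log (T - t)) / (T - t) with hBf
  set Bf' : ℝ → ℝ := fun t => (C₀ + κ * Real.log (T - t) - κ) / (T - t) ^ 2 with hBf'
  set hf : ℝ → ℝ := fun t => c / (T - t) ^ 2 with hhf
  -- the numerator `y(t) = C₀ + κ log (T − t)` stays `≥ y₀` on `[t₀, τ]` and equals `y₀` at `τ`
  have hyτ : C₀ + κ * Real.log (T - τ) = y₀ := by
    rw [hTτ, Real.log_mul hTt₀.ne' hρ0.ne', hlogρ, hC₀, mul_add, mul_neg, mul_div_cancel₀ _ hκ0.ne']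
    ring
  have hyge : ∀ t ∈ Icc t₀ τ, y₀ ≤ C₀ + κ * Real.log (T - t) := by
    intro t ht
    have hTt : 0 < T - t := by linarith [ht.2]
    have hlog : Real.log (T - τ) ≤ Real.log (T - t) := Real.log_le_log hTτ0 (by linarith [ht.2])
    have := mul_le_mul_of_nonneg_left hlog hκ0.le
    linarith [hyτ]
  have hslab1 : ∀ t ∈ Icc t₀ τ, ∀ (x e : EuclideanSpace ℝ (Fin 3)), ‖e‖ = 1 →
      strainQuad u t x e ≤ Bf t := by
    have hBc : ContinuousOn Bf (Icc t₀ τ) := by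
      have h1 : ContinuousOn (fun t : ℝ => T - t) (Icc t₀ τ) := continuousOn_const.sub continuousOn_id
      have hne : ∀ t ∈ Icc t₀ τ, T - t ≠ 0 := fun t ht => by
        have : t ≤ τ := ht.2; exact (show (0:ℝ) < T - t by linarith).ne'
      have h2 : ContinuousOn (fun t : ℝ => C₀ + κ * Real.log (T - t)) (Icc t₀ τ) :=
        continuousOn_const.add (continuousOn_const.mul (h1.log hne))
      exact h2.div h1 hne
    have hBpos : ∀ t ∈ Icc t₀ τ, 0 < Bf t := by
      intro t ht
      have hTt : 0 < T - t := by linarith [ht.2]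
      exact div_pos (hy₀.trans_le (hyge t ht)) hTt
    have hBd : ∀ t ∈ Icc t₀ τ, HasDerivWithinAt Bf (Bf' t) (Icc t₀ τ) t := by
      intro t ht
      have hTt : 0 < T - t := by linarith [ht.2]
      have hlin : HasDerivAt (fun r : ℝ => T - r) (-1) t := by
        simpa using (hasDerivAt_id t).const_sub T
      have hlog : HasDerivAt (fun r : ℝ => Real.log (T - r)) ((-1) / (T - t)) t := hlin.log hTt.ne'
      have hnum : HasDerivAt (fun r : ℝ => C₀ + κ * Real.log (T - r)) (0 + κ * ((-1) / (T - t))) t :=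
        (hasDerivAt_const t C₀).add (hlog.const_mul κ)
      have hquot := hnum.div hlin hTt.ne'
      have hTt' : T - t ≠ 0 := hTt.ne'
      refine (hquot.congr_deriv ?_).hasDerivWithinAt
      simp only [hBf']
      field_simp
      ring
    have hsuper : ∀ t ∈ Icc t₀ τ, -(Bf t) ^ 2 + hf t ≤ Bf' t := by
      intro t ht
      have hTt : 0 < T - t := by linarith [ht.2]
      have hy := hquad _ (hyge t ht)
      simp only [hBf, hBf', hhf]
      rw [div_pow]
      have h1 : -((C₀ + κ * Real.log (T - t)) ^ 2 / (T - t) ^ 2) + c / (T - t) ^ 2 =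
          (c - (C₀ + κ * Real.log (T - t)) ^ 2) / (T - t) ^ 2 := by ring
      rw [h1, div_le_div_iff_of_pos_right (by positivity)]
      linarith [hy]
    have hrate : ∀ t ∈ Ioc t₀ τ, ∀ (x e : EuclideanSpace ℝ (Fin 3)), IsStrainArgmax u t x e →
        Bf t < strainQuad u t x e → strainRate T u t x e ≤ -(strainQuad u t x e) ^ 2 + hf t := by
      intro t ht x e hax hbig
      have hTt : 0 < T - t := by linarith [ht.2]
      have htI : t ∈ Ico t₀ T := ⟨ht.1.le, by linarith [ht.2]⟩
      have hy := hyge t ⟨ht.1.le, ht.2⟩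
      have hline : y₀ < (T - t) * strainQuad u t x e := by
        have h1 : (T - t) * Bf t = C₀ + κ * Real.log (T - t) := by
          simp only [hBf]; rw [mul_div_cancel₀ _ hTt.ne']
        have h2 : (T - t) * Bf t < (T - t) * strainQuad u t x e := mul_lt_mul_of_pos_left hbig hTt
        linarith
      exact hgrowth t htI x e hax hline
    have hinit : ∀ (x e : EuclideanSpace ℝ (Fin 3)), ‖e‖ = 1 → strainQuad u t₀ x e ≤ Bf t₀ := by
      intro x e he
      have h1 : Bf t₀ = Y / (T - t₀) := by simp only [hBf, hC₀]; ring
      rw [h1, le_div_iff₀ hTt₀]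
      have h2 := hM x e he
      have h3 : strainQuad u t₀ x e * (T - t₀) ≤ M * (T - t₀) := mul_le_mul_of_nonneg_right h2 hTt₀.le
      rw [hY]; nlinarith
    exact hTh ν T t₀ τ hν ht₀ ht₀τ hτT u p hsol hreg Bf Bf' hf hBc hBpos hBd hsuper
      (fun t _ => div_nonneg hc0 (sq_nonneg _)) hrate hinit
  -- the value at `τ`: `⟪∇u(τ,x)e,e⟫ ≤ y₀ / (T − τ)`
  have hatτ : ∀ (x e : EuclideanSpace ℝ (Fin 3)), ‖e‖ = 1 → strainQuad u τ x e ≤ y₀ / (T - τ) := by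
    intro x e he
    have h := hslab1 τ ⟨ht₀τ.le, le_rfl⟩ x e he
    simp only [hBf] at h
    rwa [hyτ] at h
  -- ### Step 4: slab 2, `[τ, t₂]` for every `t₂ < T`, barrier `B₂ = y₀ / (T − t)`
  have hslab2 : ∀ t ∈ Ico τ T, ∀ (x e : EuclideanSpace ℝ (Fin 3)), ‖e‖ = 1 →
      (T - t) * strainQuad u t x e ≤ y₀ := by
    intro t ht x e he
    set t₂ : ℝ := (t + T) / 2 with ht₂
    have hτt₂ : τ < t₂ := by rw [ht₂]; linarith [ht.1, ht.2]
    have ht₂T : t₂ < T := by rw [ht₂]; linarith [ht.2]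
    have htt₂ : t ≤ t₂ := by rw [ht₂]; linarith [ht.2]
    set B₂ : ℝ → ℝ := fun s => y₀ / (T - s) with hB₂
    set B₂' : ℝ → ℝ := fun s => y₀ / (T - s) ^ 2 with hB₂'
    set h₂ : ℝ → ℝ := fun s => c / (T - s) ^ 2 with hh₂
    have hpos : ∀ s ∈ Icc τ t₂, 0 < T - s := fun s hs => by linarith [hs.2]
    have hBc : ContinuousOn B₂ (Icc τ t₂) :=
      continuousOn_const.div (continuousOn_const.sub continuousOn_id) fun s hs => (hpos s hs).ne'
    have hBpos : ∀ s ∈ Icc τ t₂, 0 < B₂ s := fun s hs => div_pos hy₀ (hpos s hs)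
    have hBd : ∀ s ∈ Icc τ t₂, HasDerivWithinAt B₂ (B₂' s) (Icc τ t₂) s := by
      intro s hs
      have hTs := hpos s hs
      have hlin : HasDerivAt (fun r : ℝ => T - r) (-1) s := by
        simpa using (hasDerivAt_id s).const_sub T
      have hquot := (hasDerivAt_const s y₀).div hlin hTs.ne'
      have hTs' : T - s ≠ 0 := hTs.ne'
      refine (hquot.congr_deriv ?_).hasDerivWithinAt
      simp only [hB₂']
      field_simp
      ring
    have hsuper : ∀ s ∈ Icc τ t₂, -(B₂ s) ^ 2 + h₂ s ≤ B₂' s := by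
      intro s hs
      have hTs := hpos s hs
      simp only [hB₂, hB₂', hh₂]
      rw [div_pow]
      have hc' : c ≤ y₀ + y₀ ^ 2 := by nlinarith
      have h1 : -(y₀ ^ 2 / (T - s) ^ 2) + c / (T - s) ^ 2 = (c - y₀ ^ 2) / (T - s) ^ 2 := by ring
      rw [h1, div_le_div_iff_of_pos_right (by positivity)]
      linarith
    have hrate : ∀ s ∈ Ioc τ t₂, ∀ (x e : EuclideanSpace ℝ (Fin 3)), IsStrainArgmax u s x e →
        B₂ s < strainQuad u s x e → strainRate T u s x e ≤ -(strainQuad u s x e) ^ 2 + h₂ s := by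
      intro s hs x' e' hax hbig
      have hTs : 0 < T - s := by linarith [hs.2]
      have hsI : s ∈ Ico t₀ T := ⟨(ht₀τ.trans hs.1).le, by linarith [hs.2]⟩
      have hline : y₀ < (T - s) * strainQuad u s x' e' := by
        have h1 : (T - s) * B₂ s = y₀ := by simp only [hB₂]; rw [mul_div_cancel₀ _ hTs.ne']
        have h2 : (T - s) * B₂ s < (T - s) * strainQuad u s x' e' := mul_lt_mul_of_pos_left hbig hTs
        linarith
      exact hgrowth s hsI x' e' hax hline
    have hinit : ∀ (x e : EuclideanSpace ℝ (Fin 3)), ‖e‖ = 1 → strainQuad u τ x e ≤ B₂ τ := by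
      intro x' e' he'
      simp only [hB₂]
      exact hatτ x' e' he'
    have hmain := hTh ν T τ t₂ hν hτ0 hτt₂ ht₂T u p hsol hreg B₂ B₂' h₂ hBc hBpos hBd hsuper
      (fun s _ => div_nonneg hc0 (sq_nonneg _)) hrate hinit
    have h := hmain t ⟨ht.1, htt₂⟩ x e he
    have hTt : 0 < T - t := sub_pos.2 ht.2
    simp only [hB₂] at h
    rw [le_div_iff₀ hTt] at h
    linarith
  -- ### Step 5: door Λ on `[τ, T)`
  exact hΛ ν T τ y₀ hν hτ0 hτT hy₀1 u p hsol hreg hslab2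

end Summit.NavierStokesRegularity.NavierStokesRegularity.Theorems.StrainDoors

end
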